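import Literature.MathematicalPhysics.QuantumFieldTheory.Balaban1983to89.B9QLettersAtPins
import Literature.MathematicalPhysics.QuantumFieldTheory.Balaban1983to89.B9CoReadingCoordsTranspose
import Literature.MathematicalPhysics.QuantumFieldTheory.Balaban1983to89.Node00.OpsYSectDESymm
import Literature.MathematicalPhysics.QuantumFieldTheory.Balaban1983to89.Node00.OpsYRecordV4P
import Literature.MathematicalPhysics.QuantumFieldTheory.Balaban1983to89.B9Thm311AdjointPairs
import Literature.MathematicalPhysics.QuantumFieldTheory.Balaban1983to89.B6RandomWalkL2Chain

/-!
# `Balaban1983to89.B9Eq3126HTransposeCoords` — [B9] (3.126) `H = GQ\*(QGQ\*)⁻¹` read BACKWARDS: the COUNTING-TRANSPOSE of the coordinate model of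
# def-Y's `H(U)` is the explicit composite `C ∘ Q ∘ G_D` (all three letters trace-symmetric ∕ adjoint at gauge-group-valued `U`), and its [4]-(2.51)
# majorant follows from the three letters' majorants by (2.55)–(2.56) — the inhabitant road of the transpose letter `hHT` of seat n06-w8's (H\*J) files

T. Bałaban, *Propagators for lattice gauge theories in a background field*, Commun. Math. Phys. **99** (1985) 389–434 [`Balaban1985BackgroundPropagators`,
"B9"]; [4] = T. Bałaban, *Propagators and renormalization transformations for lattice gauge theories. II*, Commun. Math. Phys. **96** (1984) 223–250
[`Balaban1984PropagatorsII`].  statement-level skeleton of published theorems with citation tags; proofs where landed; nothing here is a claim about the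
Yang–Mills mass gap.

THE PRINT.  p. 420, (3.126): *"HB = GQ\*(QGQ\*)⁻¹B"*; p. 392–393: `Q\*` is the adjoint of `Q` for the scalar products ((3.13) p. 392); Thm 3.11 p. 416: `G` *"is a symmetric …
operator"*; (3.123)∕(3.132): `(QGQ\*)⁻¹`.  Hence `H\* = (QGQ\*)⁻¹ Q G` — the transpose of `H` is a composite of the SAME three letters.

THE POINT (seat n06-w8 g2′, CLAIM-6 = LOCATED-(B″), cell bus 2026-08-28; WIDTH-209 N06).  `B9Eq3136HstarJBound` (F7) + `…N06HstarJAtPinsPhys` (F8) turn the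
N06 certificate's `(H\*J)` letter into a theorem of a DISPLAYED transpose letter `hHT`: «the scaled coordinate model `HcoK … (HDY …) U` (n06-d `B9CoReadingCoordsH`)
has a counting-transpose `T′` (`B9Thm37Glue.IsTransposePair`) with a [4]-(2.51) `HasMajorantHom` from the fine bonds (blocks `blkBK bI`) to the coarse bonds
(blocks `blkHK`)».  THIS FILE inhabits the first half and reduces the second to three letters:
* §1 ★ `isTransposePair_CcoK` — the model `CcoK` of `C = (QGQ\*)⁻¹` is its own counting-transpose at a `G`-valued configuration, `G ≦ U(N)`, taxicab
  transporters `parBY` and a trace-symmetric `G_D` (def-Y `QGQinvOfY_isSymmTr` + `B9Thm311AdjointPairs.isAdjTr_QY_QsY_parBY` + n06-d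
  `isTransposePair_coordOpK_of_isSymmTr`, BY NAME); ★★ `isTransposePair_HcoK_HDY` — `IsTransposePair (HcoK … (HDY i parS parBY Gp) U₁)
  ((CcoK … ∘ₗ QcoKH …) ∘ₗ GcoK … (GDY …) U₁)` (def-Y `OpsYSectDCoords.HcoK_HDY_eq` = (3.126) at the pins + `isTransposePair_QcoKH_QscoKH` + n06-d
  `isTransposePair_GcoK_trBasis` + `IsTransposePair.comp`); `isTransposePair_HcoK_HDY_parSymY` — at the record's `parSymY ∕ GpY parSymY` the symmetry of
  `G_D` is def-Y's `GDY_isSymmTr_parSymY` (no hypothesis left but `G`-valuedness); (v1.2) `isTransposePair_HcoK_HDY_physY` — the same at the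
  P-record's `G′_phys = GpPhysY parSymY` (the certificate's pinned H letter, `hHm12`), def-Y's `GDY_GpPhysY_isSymmTr_parSymY`;
* §2 ★★ `hasMajorantHom_CQG_of_letters` — the [4]-(2.51) majorant of `(C ∘ Q) ∘ G_D` from the fine carrier to the coarse one: G_D's sup majorant
  `r_G·e^{−(1−α)δ d}` (Thm 3.12 (3.130)'s shape; a hypothesis), Q's = n06-w5's THEOREM `B9QLettersAtPins.hasMajorantHom_QcoKH` (local contraction,
  `e^{δ(ℓ+4)}·e^{−δd}`; needs the 1-faithful pin `hβ1` and contracting transporters), C's sup majorant WITH A WEIGHT AT THE OUTPUT coarse bond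
  `r_C·W_C(a)·e^{−(1−α)²δ… d}` ((3.132)'s shape; a hypothesis — at the flat record `W_C = n_a`, the block count, n06-h∕def-Y (W2)); two convolutions by
  `B6RandomWalkHom.hom_majorant_mul_265` and `B6RandomWalkL2Chain.kernel_G0_conv_le` ((2.54) + (2.61), one `c₁` each).
HONEST SCOPE.  Finite-dimensional transposition bookkeeping and [4] (2.51)∕(2.54)∕(2.55)∕(2.61) with explicit constants; the majorants of `G_D` ((3.130)) and of
`C` ((3.132)) are HYPOTHESES of printed shape; nothing of [B9] asserted; count-neutral; N06 NOT discharged; one finite lattice at a time — nothing continuum ∕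
ℝ⁴ ∕ OS ∕ mass gap ∕ Clay.  Cell `pub-ymgap` (HUMAN RULING D-0062), Track A node N06 [B9], seat `pub-ymgap-dag-n06-w8` (g2′), 2026-08-28.  NEW file (v1.1: DOC-ONLY loci fix after the [B9] page owner's check, «(3.12)–(3.13) p.392, (3.14) p.393»; no statement, body or name
touched; v1.2 APPEND-ONLY: `isTransposePair_HcoK_HDY_physY`, + import `Node00.OpsYRecordV4P`); def-Y's `Node00.OpsYSectDCoords ∕ OpsYSectDESymm`, n06-d's `B9CoReadingCoordsTranspose`, n06-w5's `B9QLettersAtPins` consumed BY NAME, nothing restated.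
-/

noncomputable section

namespace Literature.MathematicalPhysics.QuantumFieldTheory.Balaban1983to89.B9Eq3126HTransposeCoords

open Node00 (CfgY FBondY IBondY SiteParY BondParY SiteOpY parBY parSymY GpY GpPhysY QGQinvOfY_isSymmTr GDY_isSymmTr_parSymY QGQinvY_eq_QGQinvOfY
  GDY_GpPhysY_isSymmTr_parSymY)
open Node00.OpsYSectDCoords (QcoKH QscoKH CcoK HcoK_HDY_eq isTransposePair_QcoKH_QscoKH cR39_trBasis_pos)
open B6KLevelCensusIndexV1 (KIdx)
open B9Eq3132SectDLetters (GDY HDY)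
open B9Thm37Glue (IsTransposePair)
open B9Thm37GlueTorusCov (isTransposePair_smul)
open B6RandomWalk (HasMajorant Triangle254 Ineq261)
open B6RandomWalkHom (HasMajorantHom hasMajorantHom_comp hasMajorantHom_mono hom_majorant_mul_265)
open B6RandomWalkL2Chain (kernel_G0_conv_le)
open B9Thm34Ext (toB6)
open B9CoReadingCoords (XBK blkBK GcoK)
open B9CoReadingCoordsH (XHK blkHK HcoK)
open B9CoReadingCoordsTranspose (TrIdx trBasis trBasis_repr_eq_trace isTransposePair_coordOpK_of_isSymmTr isTransposePair_GcoK_trBasis)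
open B9Thm311ReadingCoords (IsSymmTr)
open B9Thm39ReadingCoords (cR39)
open B9GeoNormsKLevelV1 (geo9K)
open B9QLettersAtPins (hasMajorantHom_QcoKH)
open B6Ineq2142KLevelV1 (β)
open B6GlobalChartV1 (blkV1)
open B6Geom246MultiLevelTorus (geomT)
open scoped Matrix
open scoped Matrix.Norms.L2Operator

variable {N : ℕ} {d ℓ : ℕ} {hd : 1 ≤ d + 1} {hL : Odd (ℓ + 1) ∧ 1 < ℓ + 1} {b₀ b₁ : ℝ}
variable (i : KIdx d ℓ hd hL b₀ b₁) (B : B9.Backgrounds) (cfg : B.Cfg → CfgY (Matrix (Fin N) (Fin N) ℂ) i)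
  (parS : SiteParY (Matrix (Fin N) (Fin N) ℂ) i) (Gp : SiteOpY (Matrix (Fin N) (Fin N) ℂ) i)

/-! ## §1 The counting-transpose of the H-model is `(C ∘ Q) ∘ G_D` -/

section Transpose

/-- ★ **THE MODEL OF `C = (QGQ\*)⁻¹` IS ITS OWN COUNTING-TRANSPOSE** at a `G`-valued configuration (`G ≦ U(N)`), taxicab transporters `parBY` and a
trace-symmetric Sect.-D propagator `G_D(U)` (`IsSymmTr 1 (GDY … U)` — e.g. def-Y's `GDY_isSymmTr_parSymY` at the record): `Q\*` is the trace-adjoint of `Q`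
(`isAdjTr_QY_QsY_parBY`), so `QG_DQ\*` and its `Ring.inverse` are trace-symmetric (`QGQinvOfY_isSymmTr`), and an orthonormal real basis turns trace-symmetry into
counting-transposition (`isTransposePair_coordOpK_of_isSymmTr`). [cite: Balaban1985BackgroundPropagators, (3.123) p.420, (3.132) p.422, p.393 (Q* the adjoint of Q), Thm 3.11 p.416 («symmetric»); Balaban1984PropagatorsII, (2.51) p.232] -/
theorem isTransposePair_CcoK {G : Subgroup (Matrix (Fin N) (Fin N) ℂ)ˣ} (hG : G ≤ B7Prop2Explicit.unitaryUnits (Matrix (Fin N) (Fin N) ℂ))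
    (U₁ : B.Cfg) (hU : ∀ μ x, cfg U₁ μ x ∈ G) (hGD : IsSymmTr (fun _ => (1 : ℝ)) (GDY i parS (parBY i) Gp (cfg U₁))) :
    IsTransposePair (CcoK i (trBasis N) B cfg parS (parBY i) Gp U₁) (CcoK i (trBasis N) B cfg parS (parBY i) Gp U₁) := by
  have hC : IsSymmTr (fun _ => (1 : ℝ)) (B9Eq3132SectDLetters.QGQinvY i parS (parBY i) Gp (cfg U₁)) := by
    rw [QGQinvY_eq_QGQinvOfY]
    exact QGQinvOfY_isSymmTr i (parBY i) (cfg U₁) _ (B9Thm311AdjointPairs.isAdjTr_QY_QsY_parBY i hG (cfg U₁) hU) hGD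
  unfold CcoK
  exact isTransposePair_smul (isTransposePair_coordOpK_of_isSymmTr (trBasis N) (trBasis_repr_eq_trace N) _ hC) _

/-- ★★ **THE COUNTING-TRANSPOSE OF THE H-MODEL IS `(C ∘ Q) ∘ G_D`** ((3.126) read backwards): at a `G`-valued configuration (`G ≦ U(N)`), taxicab
transporters and a trace-symmetric `G_D(U)`, `IsTransposePair (HcoK … (HDY i parS parBY Gp) U₁) ((CcoK … ∘ₗ QcoKH …) ∘ₗ GcoK … (GDY …) U₁)` —
def-Y's `HcoK_HDY_eq` (`HcoK(H) = GcoK(G_D) ∘ QscoKH ∘ CcoK`), the transposes of the three factors (`isTransposePair_GcoK_trBasis`,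
`isTransposePair_QcoKH_QscoKH`, `isTransposePair_CcoK`) and `IsTransposePair.comp`. [cite: Balaban1985BackgroundPropagators, (3.126) p.420, p.393, Thm 3.11 p.416; Balaban1984PropagatorsII, (2.51) p.232] -/
theorem isTransposePair_HcoK_HDY {G : Subgroup (Matrix (Fin N) (Fin N) ℂ)ˣ} (hG : G ≤ B7Prop2Explicit.unitaryUnits (Matrix (Fin N) (Fin N) ℂ))
    (hN : 0 < N) (U₁ : B.Cfg) (hU : ∀ μ x, cfg U₁ μ x ∈ G) (hGD : IsSymmTr (fun _ => (1 : ℝ)) (GDY i parS (parBY i) Gp (cfg U₁))) :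
    IsTransposePair (HcoK i (trBasis N) B cfg (HDY i parS (parBY i) Gp) U₁)
      ((CcoK i (trBasis N) B cfg parS (parBY i) Gp U₁ ∘ₗ QcoKH i (trBasis N) B cfg (parBY i) U₁) ∘ₗ GcoK i (trBasis N) B cfg (GDY i parS (parBY i) Gp) U₁) := by
  have hc : cR39 (trBasis N) ≠ 0 := (cR39_trBasis_pos hN).ne'
  rw [HcoK_HDY_eq (i := i) (b := trBasis N) (B := B) (cfg := cfg) (parS := parS) (parB := parBY i) (Gp := Gp) hc U₁]
  have hGt := isTransposePair_GcoK_trBasis i B cfg (GDY i parS (parBY i) Gp) U₁ hGD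
  have hQt : IsTransposePair (QscoKH i (trBasis N) B cfg (parBY i) U₁) (QcoKH i (trBasis N) B cfg (parBY i) U₁) :=
    (isTransposePair_QcoKH_QscoKH i B cfg U₁ hG hU).symm
  have hCt := isTransposePair_CcoK i B cfg parS Gp hG U₁ hU hGD
  exact (hCt.comp hQt).comp hGt

/-- ★★ at the record's transporters `parSymY` and `G′ = GpY parSymY` (the v4 `H` of def-Y's residual `resYOfC2`): NO symmetry hypothesis left — def-Y's
`GDY_isSymmTr_parSymY`. [cite: Balaban1985BackgroundPropagators, (3.126) p.420, Thm 3.11 p.416] -/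
theorem isTransposePair_HcoK_HDY_parSymY {G : Subgroup (Matrix (Fin N) (Fin N) ℂ)ˣ} (hG : G ≤ B7Prop2Explicit.unitaryUnits (Matrix (Fin N) (Fin N) ℂ))
    (hN : 0 < N) (U₁ : B.Cfg) (hU : ∀ μ x, cfg U₁ μ x ∈ G) :
    IsTransposePair (HcoK i (trBasis N) B cfg (HDY i (parSymY i) (parBY i) (GpY i (parSymY i))) U₁)
      ((CcoK i (trBasis N) B cfg (parSymY i) (parBY i) (GpY i (parSymY i)) U₁ ∘ₗ QcoKH i (trBasis N) B cfg (parBY i) U₁) ∘ₗ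
        GcoK i (trBasis N) B cfg (GDY i (parSymY i) (parBY i) (GpY i (parSymY i))) U₁) :=
  isTransposePair_HcoK_HDY i B cfg (parSymY i) (GpY i (parSymY i)) hG hN U₁ hU (GDY_isSymmTr_parSymY i hG hU)

/-- ★★ (v1.2) at the P-record's transporters `parSymY` and PRINT-UNITS site propagator `G′_phys = GpPhysY parSymY` — the certificate's own H letter
(`(lettersYOfRecordV4P …).H U = HDY … (GpPhysY …) U`, pin `hHm12`): NO symmetry hypothesis left — def-Y's `GDY_GpPhysY_isSymmTr_parSymY`.
[cite: Balaban1985BackgroundPropagators, (3.126) p.420, (3.24)–(3.25) p.394, Thm 3.11 p.416] -/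
theorem isTransposePair_HcoK_HDY_physY {G : Subgroup (Matrix (Fin N) (Fin N) ℂ)ˣ} (hG : G ≤ B7Prop2Explicit.unitaryUnits (Matrix (Fin N) (Fin N) ℂ))
    (hN : 0 < N) (U₁ : B.Cfg) (hU : ∀ μ x, cfg U₁ μ x ∈ G) :
    IsTransposePair (HcoK i (trBasis N) B cfg (HDY i (parSymY i) (parBY i) (GpPhysY i (parSymY i))) U₁)
      ((CcoK i (trBasis N) B cfg (parSymY i) (parBY i) (GpPhysY i (parSymY i)) U₁ ∘ₗ QcoKH i (trBasis N) B cfg (parBY i) U₁) ∘ₗ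
        GcoK i (trBasis N) B cfg (GDY i (parSymY i) (parBY i) (GpPhysY i (parSymY i))) U₁) :=
  isTransposePair_HcoK_HDY i B cfg (parSymY i) (GpPhysY i (parSymY i)) hG hN U₁ hU (GDY_GpPhysY_isSymmTr_parSymY i hG hU)

end Transpose

/-! ## §2 The [4]-(2.51) majorant of `(C ∘ Q) ∘ G_D` from the three letters -/

section Majorant

variable {R₀ : ℝ} {H₀ : Prop}

/-- ★★ **THE MAJORANT OF THE TRANSPOSE COMPOSITE FROM THE THREE LETTERS**: over the record geometry `geo9K i` (blocks `blkBK bI` on the fine bonds, `blkHK` on the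
coarse bonds; `bI` 1-faithful), at a configuration with contracting taxicab transporters: if the model of `G_D(U)` has the sup majorant `r_G·e^{−(1−α)δ d}`
((3.130)'s shape, after its scale weight has been transferred into the rate) and the model of `C(U)` the sup majorant `r_C·W_C(a)·e^{−δ d}` WITH A WEIGHT `W_C ≧ 0`
at the output coarse bond ((3.132)'s shape; at the flat record `W_C = n_a`), then — Q's majorant `e^{δ(ℓ+4)}·e^{−δd}` being n06-w5's theorem — `(C ∘ Q) ∘ G_D` has
the [4]-(2.51) majorant `r_C·c₁·W_C(a)·(e^{δ(ℓ+4)}·c₁·r_G)·e^{−(1−α)δ d(a, y′)}` from the fine carrier to the coarse one (`c₁ = c₁(δ, α)` of (2.61); (2.55)–(2.56):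
two convolutions, one `c₁` each). [cite: Balaban1985BackgroundPropagators, (3.126) p.420, (3.130) p.421, (3.132)–(3.133) p.422, (3.12)–(3.13) p.392, (3.14) p.393; Balaban1984PropagatorsII, (2.51)–(2.56) pp.232–233, Lemma 2.1 (2.61) p.234, (2.66) p.234] -/
theorem hasMajorantHom_CQG_of_letters [Fintype (geo9K i).Site] {bI : FBondY i → IBondY i}
    (hβ1 : ∀ f : FBondY i, (geomT i.D).dist (β i.hN i.D i.hk (bI f)) (blkV1 i.hN i.D f) ≤ 1) (U₁ : B.Cfg)
    (hpar : ∀ s s', ‖(parBY i (cfg U₁) s s' : Matrix (Fin N) (Fin N) ℂ)‖ ≤ 1 ∧ ‖(((parBY i (cfg U₁) s s')⁻¹ : (Matrix (Fin N) (Fin N) ℂ)ˣ) : Matrix (Fin N) (Fin N) ℂ)‖ ≤ 1)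
    (htri : Triangle254 (toB6 (geo9K i) R₀ H₀)) {dd : ℕ} {δ α rG rC : ℝ} {WC : (geo9K i).Site → ℝ}
    (hδ : 0 ≤ δ) (hαδ : 0 ≤ (1 - α) * δ) (hrG : 0 ≤ rG) (hrC : 0 ≤ rC) (hWC : ∀ a, 0 ≤ WC a)
    (h261 : Ineq261 dd (toB6 (geo9K i) R₀ H₀) δ α)
    {CC : (XHK (TrIdx N) i → ℝ) →ₗ[ℝ] (XHK (TrIdx N) i → ℝ)} {GG : (XBK (TrIdx N) i → ℝ) →ₗ[ℝ] (XBK (TrIdx N) i → ℝ)}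
    (hG : HasMajorant (g := toB6 (geo9K i) R₀ H₀) (blkBK i bI) GG (fun a b => rG * Real.exp (-((1 - α) * δ * (geo9K i).dist a b))))
    (hC : HasMajorant (g := toB6 (geo9K i) R₀ H₀) (blkHK i) CC (fun a b => rC * WC a * Real.exp (-(δ * (geo9K i).dist a b)))) :
    HasMajorantHom (g := toB6 (geo9K i) R₀ H₀) (blkBK i bI) (blkHK i) ((CC ∘ₗ QcoKH i (trBasis N) B cfg (parBY i) U₁) ∘ₗ GG)
      (fun a b => rC * B6.c1 dd δ α * WC a * (Real.exp (δ * ((ℓ : ℝ) + 4)) * B6.c1 dd δ α * 1 * rG) *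
        Real.exp (-((1 - α) * δ * (geo9K i).dist a b))) := by
  -- Q : fine → coarse, local contraction (n06-w5)
  have hQ := hasMajorantHom_QcoKH i (trBasis N) B cfg (parBY i) hβ1 (U₁ := U₁) hpar hδ R₀ H₀
  -- (1) `Q ∘ G_D` by (2.66): the `y″`-sum costs one `c₁`
  have hQG : HasMajorantHom (g := toB6 (geo9K i) R₀ H₀) (blkBK i bI) (blkHK i) (QcoKH i (trBasis N) B cfg (parBY i) U₁ ∘ₗ GG)
      (fun a b => Real.exp (δ * ((ℓ : ℝ) + 4)) * B6.c1 dd δ α * 1 * rG * Real.exp (-((1 - α) * δ * (geo9K i).dist a b))) :=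
    hom_majorant_mul_265 (blkBK i bI) (blkHK i) dd δ α (Real.exp (δ * ((ℓ : ℝ) + 4))) rG (fun _ => (1 : ℝ)) (Real.exp_nonneg _)
      (fun _ => zero_le_one) hrG hαδ htri h261 (hasMajorantHom_mono _ _ hQ fun a b => by rw [mul_one]; exact le_rfl) hG
  -- (2) `C ∘ (Q ∘ G_D)`: insert the partition on the coarse lattice, then convolve the two exponential kernels (one more `c₁`)
  have hc1 : ∀ a : (geo9K i).Site, 0 ≤ B6.c1 dd δ α := fun a =>
    le_trans (Finset.sum_nonneg fun _ _ => Real.exp_nonneg _) (h261 a)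
  have hr : ∀ a : (geo9K i).Site, 0 ≤ Real.exp (δ * ((ℓ : ℝ) + 4)) * B6.c1 dd δ α * 1 * rG := fun a => by
    have h := hc1 a; positivity
  have hK₂ : ∀ a b : (geo9K i).Site, 0 ≤ Real.exp (δ * ((ℓ : ℝ) + 4)) * B6.c1 dd δ α * 1 * rG * Real.exp (-((1 - α) * δ * (geo9K i).dist a b)) :=
    fun a b => mul_nonneg (hr a) (Real.exp_nonneg _)
  have hcomp := hasMajorantHom_comp (g := toB6 (geo9K i) R₀ H₀) (blkBK i bI) (blkHK i) (blkHK i) (T₁ := CC)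
    (T₂ := QcoKH i (trBasis N) B cfg (parBY i) U₁ ∘ₗ GG) ((B6RandomWalkHom.hasMajorantHom_iff _ _ _).2 hC) hQG hK₂
  rw [← LinearMap.comp_assoc] at hcomp
  refine hasMajorantHom_mono _ _ hcomp fun a b => ?_
  exact kernel_G0_conv_le (g := toB6 (geo9K i) R₀ H₀) dd δ α rC (Real.exp (δ * ((ℓ : ℝ) + 4)) * B6.c1 dd δ α * 1 * rG) WC hrC hWC (hr a)
    hαδ htri h261 a b

end Majorant

end Literature.MathematicalPhysics.QuantumFieldTheory.Balaban1983to89.B9Eq3126HTransposeCoords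

end
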